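import Literature.Geometry.Kaehler.ComplexTorusHodgeGroupHodgeCircleSigmaPiCMClasses
import Literature.Geometry.Kaehler.ComplexTorusLefschetzGroupFiniteProduct
import Literature.Geometry.Kaehler.ComplexTorusDivisorClassesEllipticProduct
import Literature.Geometry.Kaehler.ComplexTorusPicardNumberPoincareLength
import HarnessLib

/-!
# Every finite product of complex tori on the Hodge-circle locus is isogenous to a product of CM elliptic curves:
# it is an abelian variety with `Lf(∏ₖ X_k) = Hg(∏ₖ X_k)` for every polarisation (Hodge = Lefschetz), and it lies on the
# locus itself iff `Hom(X_k, X_l) ≠ 0` for all `k, l`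
# (Imai 1976, §3 Remarks; Moonen–Zarhin 1999, (0.2)(4), §3 Corollary; Gordon 1997, §3 and 7.5 Theorem (b); Murty 1984)

Layer `Literature/Geometry/Kaehler`, namespace `Literature.Geometry.Kaehler.ComplexTorus`; lane `lit-hodgefound` (Track 2
foundations library, Layer A1/A3 «Hodge groups of complex tori; products»), prover seat p17, generation 33, self-proposed
row g33-#8 — the `r`-factor forms of g32-#1 (`ComplexTorusHodgeGroupHodgeCircleProducts`: `X₁ × X₂` is on the locus ⟺
both factors are and `Hom(X₁, X₂) ≠ 0`) and of g32-#4 §4 (`IsRiemannForm.lefschetzGroup_prodPeriod_eq_hodgeGroup_of_…`: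
Hodge = Lefschetz for every product of TWO tori on the locus), on p10/p36's dependent product `sigmaPiPeriod Ψ`, any
finite index type.  The engine is the isogeny **`∏ₖ X_k ∼ ∏_{i < N} E_{τ_{c(i)}}`** (`N = Σₖ g_k` CM elliptic curves,
`X_k ∼ E_{τ_k}^{g_k}` by g31-#4) assembled BY NAME from `IsIsogenous.sigmaPi`, `isIsomorphic_powPeriod_sigmaPiPeriod_const`,
p10's `isIsomorphic_sigmaPiPeriod_regroup` / `isIsomorphic_piPeriod_sigmaPiPeriod` / `isIsomorphic_of_reindex`
(`ComplexTorusPoincareCompleteReducibilityPowers`, `ComplexTorusProductPowerIsomorphisms`), after which the tree's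
Murty–Gordon theorem `IsIsogenous.lefschetzGroup_eq_hodgeGroup_of_pi_ellipticPeriod` («`Lf = Hg` for everything isogenous
to a product of elliptic curves», `ComplexTorusLefschetzGroupFiniteProduct`) and
`coe_hodgeGroup_eq_range_hodgeCircleSL_iff_of_isIsogenous_pi_ellipticPeriod` (`ComplexTorusHodgeGroupHodgeCircle`) apply.
THEOREMS ONLY: no definition, no instance, no named fact, nothing conditional (D-0026, net debt 0).

## Sources, verbatim

* H. Imai, *On the Hodge groups of some abelian varieties*, Kōdai Math. Sem. Rep. 27 (1976) (held
  `paper:doi-10-2996-kmj-1138847263`), §3 Remarks (p. 370 L22–L25, L31–L38): «If `E₁` and `E₂` are isogenous elliptic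
  curves, the Hodge group of `E₁ × E₂` is … the diagonal» / «For the product of elliptic curves (isogenous or not), its Hodge
  group can be obtained as follows … `Hg(∏_{i,j} E_i^{(j)}) ≅ ∏ᵢ Δ_{m_i}(Hg(E_i))`».
* B. Moonen, Yu. Zarhin, *Hodge classes on abelian varieties of low dimension*, Math. Ann. 315 (1999) (held
  `paper:arxiv-math_9901113`), (0.2)(4) (p0002 L1–L3); §1 (p0002: «`Hg(X) ⊂ Sp_D(V, φ)`, the centralizer of `D` in
  `Sp(V, φ)`»); §3 Corollary (p0007 L80–L85).
* B. B. Gordon, *A survey of the Hodge conjecture for abelian varieties* (1997), §3 Theorem and 7.5 Theorem (b) (products of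
  elliptic curves: Hodge = Lefschetz, the Hodge ring generated by divisors; Murty).
* V. K. Murty, *Exceptional Hodge classes on certain abelian varieties*, Math. Ann. 268 (1984), Lemma 2.1 / §3.
* H. Lange, *Abelian Varieties over the Complex Numbers* (2023), §7.2.4 Exercises (4) (a), (c) (`Lf` and products), (5);
  §2.4.4 Thm. 2.4.25, Cor. 2.4.24 (products of polarised abelian varieties), §5.1.5 Exercise (3)(b).
* A. Beauville, *Some surfaces with maximal Picard number* (2014), §3 Prop. 3, §4 Lemma 1.
* B. van Geemen, *An introduction to the Hodge conjecture for abelian varieties*, LNM 1594 (1994), §4 Thm. 4.3 (Tate: for a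
  product of elliptic curves the space of Hodge classes `B^p` is spanned by products of divisor classes).
* K. Hulek, R. Laface, *On the Picard numbers of abelian varieties*, Ann. Sc. Norm. Super. Pisa (2019), §2.1 Cor. 2.3
  («`ρ(∏ A_i^{n_i}) = Σ ρ(A_i^{n_i})`» for simple pairwise non-isogenous `A_i`), §3.1 Prop. 3.1.

## What is proved (real points; `κ` finite, `X_k = F_k/Ψ_k(ℤ^{σ k})` on the locus, `dim X_k = g_k ≥ 1`, `∏ₖ X_k = sigmaPiPeriod Ψ`)

* §1 `isIsomorphic_sigmaPiPeriod_comp_equiv`: relabelling the factors along `e : κ' ≃ κ` is an isomorphism of complex tori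
  (any family); `homRat_eq_bot_of_isIsogenous_powPeriod_of_homRat_eq_bot`: `X₁ ∼ Y₁^{m₁}`, `X₂ ∼ Y₂^{m₂}`, `Hom(Y₁, Y₂) = 0` ⟹
  `Hom(X₁, X₂) = 0` (any tori).
* §2 **`exists_isIsogenous_piPeriod_ellipticPeriod_of_coe_eq_range`: `∏ₖ X_k ∼ E_{τ_{c(1)}} × ⋯ × E_{τ_{c(N)}}`**, `N = Σₖ g_k`,
  `c : Fin N → κ` onto, `τ_k` imaginary quadratic with `X_k ∼ E_{τ_k}^{g_k}` — every finite product of tori on the locus is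
  isogenous to a product of CM elliptic curves; on the locus **`Hom(X_k, X_l) = 0` ⟺ `E_{τ_k} ≁ E_{τ_l}`**
  (`homRat_eq_bot_iff_not_isIsogenous_ellipticPeriod_of_isIsogenous_ellipticPow`).
* §3 **`isAbelianVariety_sigmaPiPeriod_of_coe_eq_range`** (the product is an abelian variety) and **HODGE = LEFSCHETZ FOR EVERY
  FINITE PRODUCT OF TORI ON THE LOCUS, EVERY POLARISATION**: `Lf(∏ₖ X_k)(ℝ) = Hg(∏ₖ X_k)(ℝ)`
  (`IsRiemannForm.lefschetzGroup_sigmaPiPeriod_eq_hodgeGroup_of_coe_eq_range`, both branches of the dichotomy at once; Gordon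
  7.5 (b) / Murty for `∏ₖ E_{τ_k}^{g_k}`); on the split branch `Lf(∏ₖ X_k) = ∏ₖ h_k(S¹)` for every polarisation
  (`IsRiemannForm.lefschetzGroup_sigmaPiPeriod_eq_map_of_…`), and off it `Lf(∏ₖ X_k, η) < ∏ₖ Lf(X_k, ω_k)`
  (`IsRiemannForm.lefschetzGroup_sigmaPiPeriod_lt_map_of_homRat_ne_bot`: Lemma 2.15's `Hom`-orthogonality hypothesis is needed).
* §4 **THE PRODUCT IS ON THE LOCUS ⟺ `Hom(X_k, X_l) ≠ 0` FOR ALL `k ≠ l`** (`coe_hodgeGroup_sigmaPiPeriod_eq_range_iff_forall_homRat_ne_bot`: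
  all the CM curves isogenous, `∏ₖ X_k ∼ E^{Σ g_k}`; the `r`-factor form of g32-#1), and then `dim_ℝ 𝔥𝔤_ℝ(∏ₖ X_k) = 1`.
* §5 **TATE'S THEOREM FOR THE PRODUCT: `Dᵖ(∏ₖ X_k) = H^{2p}_Hodge(∏ₖ X_k)` FOR ALL `p`** — the Hodge classes of every finite
  product of tori on the locus are spanned by products of divisor classes (the tree's `IsIsogenous.divisorClasses_eq_hodgeClasses_of_pi_ellipticPeriod`,
  van Geemen Thm. 4.3 / Gordon §3, along §2): `divisorClasses_sigmaPiPeriod_eq_hodgeClasses_of_coe_eq_range`.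
* §6 **THE PICARD NUMBER OF THE PRODUCT**: `∏ₖ X_k ∼ ∏_ν E_{τ_ν}^{n_ν}` with the `E_{τ_ν}` pairwise non-isogenous CM curves,
  `n_ν ≥ 1`, `Σ_ν n_ν = Σₖ g_k`, `r ≤ #κ` classes (`exists_isIsogenous_sigmaPi_ellipticPow_of_coe_eq_range`), hence
  **`ρ(∏ₖ X_k) = Σ_ν n_ν²`** (`exists_finrank_neronSeveriGroup_sigmaPiPeriod_eq_sum_sq_of_coe_eq_range`: Hulek–Laface Cor. 2.3
  `finrank_neronSeveriGroup_powers` + `ρ(E_τⁿ) = n²`); `Σₖ g_k² ≤ ρ(∏ₖ X_k) ≤ (Σₖ g_k)²` with **`ρ = Σₖ g_k²` on the split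
  branch** (`finrank_neronSeveriGroup_sigmaPiPeriod_eq_sum_sq_of_pairwise_homRat_eq_bot`) and **`ρ = (Σₖ g_k)²` ⟺ all pairwise
  `Hom ≠ 0`** (`finrank_neronSeveriGroup_sigmaPiPeriod_eq_sq_iff_forall_homRat_ne_bot`, maximal Picard number ⟺ on the locus).

## References

* [Imai1976HodgeGroups] H. Imai, Kōdai Math. Sem. Rep. 27 (1976) 367–372, §3 Remarks. [cite: Imai1976HodgeGroups, §3 Remarks (p. 370 L22–L25, L31–L38)]
* [MoonenZarhin1999LowDim] B. Moonen, Yu. Zarhin, Math. Ann. 315 (1999) 711–733, (0.2)(4), §1, §3 Corollary.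
  [cite: MoonenZarhin1999LowDim, (0.2)(4) (p0002 L1–L3), §1 (p0002) and §3 Corollary (p0007 L80–L85)]
* [Gordon1997] B. B. Gordon, *A survey of the Hodge conjecture for abelian varieties*, §3 Theorem, 7.5 Theorem (b), 2.15 Lemma.
  [cite: Gordon1997, §3 Theorem, 7.5 Theorem (b) and 2.15 Lemma]
* [Murty1984] V. K. Murty, Math. Ann. 268 (1984) 197–206, Lemma 2.1, §3. [cite: Murty1984, Lemma 2.1 and §3]
* [Lange2023AbelianVarietiesComplex] H. Lange (2023), §7.2.4 Exercises (4), (5); §2.4.4 Thm. 2.4.25, Cor. 2.4.24; §5.1.5 Exercise (3)(b).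
  [cite: Lange2023AbelianVarietiesComplex, §7.2.4 Exercises (4), (5), §2.4.4 Thm. 2.4.25 and Cor. 2.4.24]
* [Beauville2014MaximalPicard] A. Beauville, J. Éc. polytech. Math. 1 (2014), §3 Prop. 3, §4 Lemma 1. [cite: Beauville2014MaximalPicard, §3 Prop. 3 and §4 Lemma 1]
* [vanGeemen1994HodgeAV] B. van Geemen, LNM 1594 (1994), §4 Thm. 4.3. [cite: vanGeemen1994HodgeAV, §4 Thm. 4.3]
* [HulekLaface2019PicardNumbersAV] K. Hulek, R. Laface, *On the Picard numbers of abelian varieties* (2019), §2.1 Cor. 2.3,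
  §3.1 Prop. 3.1. [cite: HulekLaface2019PicardNumbersAV, §2.1 Cor. 2.3 and §3.1 Prop. 3.1]
-/

noncomputable section

open scoped Matrix Real

open Set Function Module Matrix

namespace Literature.Geometry.Kaehler

namespace ComplexTorus

/-! ## §1 Relabelling is an isomorphism; `Hom` vanishing up to isogeny and powers -/

section Relabel

variable {κ κ' : Type*} [Fintype κ] [DecidableEq κ] [Fintype κ'] [DecidableEq κ']
  {σ : κ → Type*} [∀ k, Fintype (σ k)] [∀ k, DecidableEq (σ k)]
  {F : κ → Type*} [∀ k, NormedAddCommGroup (F k)] [∀ k, NormedSpace ℂ (F k)]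
  (Ψ : ∀ k, (σ k → ℝ) ≃L[ℝ] F k) (e : κ' ≃ κ)

/-- **Relabelling the factors along `e : κ' ≃ κ` is an isomorphism of complex tori `∏ₖ X_k ≅ ∏_j X_{e(j)}`** (a reindexing of
the lattice basis along `Σ j, σ(e j) ≃ Σ k, σ k`) — an ALIAS of the tree's `isIsomorphic_sigmaPiPeriod_compEquiv`
(`ComplexTorusPicardNumberPoincareLength`), kept under this name for the users below.
[cite: Lange2023AbelianVarietiesComplex, §2.4.4 Thm. 2.4.25 (the product torus) and §1.1.1] -/
theorem isIsomorphic_sigmaPiPeriod_comp_equiv : IsIsomorphic (sigmaPiPeriod Ψ) (sigmaPiPeriod fun j ↦ Ψ (e j)) :=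
  isIsomorphic_sigmaPiPeriod_compEquiv Ψ e

end Relabel

section HomPow

variable {ι₁ ι₂ ι₁' ι₂' : Type*} [Fintype ι₁] [Fintype ι₂] [Fintype ι₁'] [Fintype ι₂'] [DecidableEq ι₁] [DecidableEq ι₂]
  [DecidableEq ι₁'] [DecidableEq ι₂']
  {E₁ E₂ E₁' E₂' : Type*} [NormedAddCommGroup E₁] [NormedSpace ℂ E₁] [NormedAddCommGroup E₂] [NormedSpace ℂ E₂]
  [NormedAddCommGroup E₁'] [NormedSpace ℂ E₁'] [NormedAddCommGroup E₂'] [NormedSpace ℂ E₂']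
  {Φ₁ : (ι₁ → ℝ) ≃L[ℝ] E₁} {Φ₂ : (ι₂ → ℝ) ≃L[ℝ] E₂} {Y₁ : (ι₁' → ℝ) ≃L[ℝ] E₁'} {Y₂ : (ι₂' → ℝ) ≃L[ℝ] E₂'}

/-- **`X₁ ∼ Y₁^{m₁}`, `X₂ ∼ Y₂^{m₂}`, `Hom_ℚ(Y₁, Y₂) = 0` ⟹ `Hom_ℚ(X₁, X₂) = 0`** (`rk Hom` is an isogeny invariant and
`Hom(Y₁^{m₁}, Y₂^{m₂}) = 0`). [cite: Lange2023AbelianVarietiesComplex, §2.4.4 Cor. 2.4.26 (proof: "`Hom(X_ν^{n_ν}, X_μ^{n_μ}) = 0` for `ν ≠ μ`")]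
[cite: Beauville2014MaximalPicard, §4 Lemma 1] -/
theorem homRat_eq_bot_of_isIsogenous_powPeriod_of_homRat_eq_bot {m₁ m₂ : ℕ} (h₁ : IsIsogenous Φ₁ (powPeriod Y₁ m₁))
    (h₂ : IsIsogenous Φ₂ (powPeriod Y₂ m₂)) (h : homRat Y₁ Y₂ = ⊥) : homRat Φ₁ Φ₂ = ⊥ := by
  rw [← Submodule.finrank_eq_zero, h₁.finrank_homRat_eq_left Φ₂, h₂.finrank_homRat_eq_right (powPeriod Y₁ m₁),
    homRat_pow_eq_bot Y₁ Y₂ h m₁ m₂, finrank_bot]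

end HomPow

/-! ## §2 `∏ₖ X_k ∼` a product of CM elliptic curves -/

section Locus

variable {κ : Type*} [Fintype κ] [DecidableEq κ] {σ : κ → Type*} [∀ k, Fintype (σ k)] [∀ k, DecidableEq (σ k)]
  {F : κ → Type*} [∀ k, NormedAddCommGroup (F k)] [∀ k, NormedSpace ℂ (F k)] [∀ k, FiniteDimensional ℂ (F k)]
  (Ψ : ∀ k, (σ k → ℝ) ≃L[ℝ] F k)

omit [Fintype κ] [DecidableEq κ] in
/-- **On the locus, `Hom_ℚ(X_k, X_l) = 0` ⟺ `E_{τ_k} ≁ E_{τ_l}`** for the CM curves with `X_k ∼ E_{τ_k}^{g_k}`, `X_l ∼ E_{τ_l}^{g_l}`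
(`g_k, g_l ≥ 1`): ⟸ by §1, ⟹ because `E_{τ_k} ∼ E_{τ_l}` puts `X_k × X_l` on the locus, where `Hom ≠ 0` (g32-#1).
[cite: Beauville2014MaximalPicard, §4 Lemma 1] [cite: MoonenZarhin1999LowDim, §3 Corollary] [cite: Imai1976HodgeGroups, §3 Remarks (p. 370 L22–L25)] -/
theorem homRat_eq_bot_iff_not_isIsogenous_ellipticPeriod_of_isIsogenous_ellipticPow {k l : κ} (hgk : 0 < finrank ℂ (F k))
    (hgl : 0 < finrank ℂ (F l)) {τk τl : ℂ} (hτk : τk.im ≠ 0) (hτl : τl.im ≠ 0) (hcm : ellipticEnd hτk ≠ ⊥)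
    (hXk : IsIsogenous (Ψ k) (powPeriod (ellipticPeriod hτk) (finrank ℂ (F k))))
    (hXl : IsIsogenous (Ψ l) (powPeriod (ellipticPeriod hτl) (finrank ℂ (F l)))) :
    homRat (Ψ k) (Ψ l) = ⊥ ↔ ¬ IsIsogenous (ellipticPeriod hτk) (ellipticPeriod hτl) := by
  constructor
  · intro hbot hiso
    have hXl' : IsIsogenous (Ψ l) (powPeriod (ellipticPeriod hτk) (finrank ℂ (F l))) :=
      hXl.trans _ _ _ ((hiso.symm _ _).pow _ _ _)
    have hc := (coe_hodgeGroup_prodPeriod_eq_range_iff_exists_isIsogenous_ellipticPow_cm (Ψ k) (Ψ l) hgk hgl).2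
      ⟨τk, hτk, hcm, hXk, hXl'⟩
    exact ((coe_hodgeGroup_prodPeriod_eq_range_iff_homRat_ne_bot (Ψ k) (Ψ l) hgk hgl).1 hc).2.2 hbot
  · intro hni
    exact homRat_eq_bot_of_isIsogenous_powPeriod_of_homRat_eq_bot hXk hXl
      (homRat_ellipticPeriod_eq_bot_of_not_isIsogenous hτk hτl hni)

/-- **EVERY FINITE PRODUCT OF TORI ON THE HODGE-CIRCLE LOCUS IS ISOGENOUS TO A PRODUCT OF CM ELLIPTIC CURVES:
`∏ₖ X_k ∼ E_{τ_{c(1)}} × ⋯ × E_{τ_{c(N)}}`**, `N = Σₖ g_k`, `c : {1, …, N} → κ` onto, `τ_k` imaginary quadratic with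
`X_k ∼ E_{τ_k}^{g_k}` (g31-#4: `Hg(X_k)(ℝ) = h(S¹)` ⟹ `X_k ∼ E_{τ_k}^{g_k}`; then `∏ₖ E_{τ_k}^{g_k} ≅ ∏_{(k,j)} E_{τ_k}` relabelled by
`{1, …, N}`). [cite: Beauville2014MaximalPicard, §3 Prop. 3] [cite: MoonenZarhin1999LowDim, (0.2)(4) (p0002 L1–L3)]
[cite: Lange2023AbelianVarietiesComplex, §2.4.4 Thm. 2.4.25] -/
theorem exists_isIsogenous_piPeriod_ellipticPeriod_of_coe_eq_range (hg : ∀ k, 0 < finrank ℂ (F k))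
    (h : ∀ k, (hodgeGroup (Ψ k) : Set (SpecialLinearGroup (σ k) ℝ)) = Set.range (hodgeCircleSL (Ψ k))) :
    ∃ (τ : κ → ℂ) (hτ : ∀ k, (τ k).im ≠ 0) (N : ℕ) (c : Fin N → κ),
      (∀ k, ∃ p q : ℚ, τ k ^ 2 + p * τ k + q = 0) ∧
      (∀ k, IsIsogenous (Ψ k) (powPeriod (ellipticPeriod (hτ k)) (finrank ℂ (F k)))) ∧
      Function.Surjective c ∧ N = ∑ k, finrank ℂ (F k) ∧
      IsIsogenous (sigmaPiPeriod Ψ) (piPeriod fun i ↦ ellipticPeriod (hτ (c i))) := by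
  have hex := fun k ↦ (coe_hodgeGroup_eq_range_iff_exists_isIsogenous_ellipticPow_quadratic (Ψ k) (hg k)).1 (h k)
  choose τ hτ hpq hX using hex
  -- one copy of `E_{τ_k}` per complex coordinate, indexed by `Σ k, Fin g_k`, then by `Fin N`
  have h1 : IsIsogenous (sigmaPiPeriod Ψ)
      (sigmaPiPeriod fun k ↦ powPeriod (ellipticPeriod (hτ k)) (finrank ℂ (F k))) :=
    IsIsogenous.sigmaPi Ψ _ hX
  have h2 : IsIsogenous (sigmaPiPeriod fun k ↦ powPeriod (ellipticPeriod (hτ k)) (finrank ℂ (F k)))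
      (sigmaPiPeriod fun k ↦ sigmaPiPeriod fun _ : Fin (finrank ℂ (F k)) ↦ ellipticPeriod (hτ k)) :=
    IsIsogenous.sigmaPi _ _ fun k ↦ (isIsomorphic_powPeriod_sigmaPiPeriod_const (ellipticPeriod (hτ k)) _).isIsogenous
  have h3 : IsIsogenous (sigmaPiPeriod fun k ↦ sigmaPiPeriod fun _ : Fin (finrank ℂ (F k)) ↦ ellipticPeriod (hτ k))
      (sigmaPiPeriod fun s : (Σ k, Fin (finrank ℂ (F k))) ↦ ellipticPeriod (hτ s.1)) :=
    (isIsomorphic_sigmaPiPeriod_regroup (fun s : (Σ k, Fin (finrank ℂ (F k))) ↦ ellipticPeriod (hτ s.1))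
      (Equiv.refl (Σ k, Fin (finrank ℂ (F k))))).symm.isIsogenous
  set e : Fin (Fintype.card (Σ k, Fin (finrank ℂ (F k)))) ≃ (Σ k, Fin (finrank ℂ (F k))) :=
    (Fintype.equivFin (Σ k, Fin (finrank ℂ (F k)))).symm with he
  have h4 : IsIsogenous (sigmaPiPeriod fun s : (Σ k, Fin (finrank ℂ (F k))) ↦ ellipticPeriod (hτ s.1))
      (sigmaPiPeriod fun i ↦ ellipticPeriod (hτ (e i).1)) :=
    (isIsomorphic_sigmaPiPeriod_comp_equiv (fun s : (Σ k, Fin (finrank ℂ (F k))) ↦ ellipticPeriod (hτ s.1)) e).isIsogenous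
  have h5 : IsIsogenous (sigmaPiPeriod fun i ↦ ellipticPeriod (hτ (e i).1)) (piPeriod fun i ↦ ellipticPeriod (hτ (e i).1)) :=
    (isIsomorphic_piPeriod_sigmaPiPeriod fun i ↦ ellipticPeriod (hτ (e i).1)).symm.isIsogenous
  refine ⟨τ, hτ, _, fun i ↦ (e i).1, hpq, hX, fun k ↦ ⟨e.symm ⟨k, ⟨0, hg k⟩⟩, by simp⟩, ?_,
    IsIsogenous.trans _ _ _ (IsIsogenous.trans _ _ _ (IsIsogenous.trans _ _ _ (IsIsogenous.trans _ _ _ h1 h2) h3) h4) h5⟩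
  rw [Fintype.card_sigma]
  exact Finset.sum_congr rfl fun k _ ↦ Fintype.card_fin _

/-! ## §3 The product is an abelian variety with Hodge = Lefschetz -/

omit [DecidableEq κ] in
/-- **A finite product of tori on the locus is an abelian variety** (each factor has maximal Picard number, hence is
polarised; `⊞ₖ ω_k` polarises the product). [cite: Beauville2014MaximalPicard, §3 Prop. 3]
[cite: Lange2023AbelianVarietiesComplex, §2.4.4 Cor. 2.4.24 and §5.1.5 Exercise (3)(b)] -/
theorem isAbelianVariety_sigmaPiPeriod_of_coe_eq_range (hg : ∀ k, 0 < finrank ℂ (F k))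
    (h : ∀ k, (hodgeGroup (Ψ k) : Set (SpecialLinearGroup (σ k) ℝ)) = Set.range (hodgeCircleSL (Ψ k))) :
    IsAbelianVariety (sigmaPiPeriod Ψ) := by
  have hω := fun k ↦ isAbelianVariety_of_coe_hodgeGroup_eq_range (hg k) (h k)
  choose ω hω using hω
  exact ⟨_, IsRiemannForm.sigmaPi hω⟩

/-- **HODGE = LEFSCHETZ FOR EVERY FINITE PRODUCT OF COMPLEX TORI ON THE HODGE-CIRCLE LOCUS, FOR EVERY POLARISATION:
`Lf(∏ₖ X_k)(ℝ) = Hg(∏ₖ X_k)(ℝ)`** — `∏ₖ X_k ∼ ∏ᵢ E_{τ_{c(i)}}` (§2) and «`Lf = Hg` for everything isogenous to a product of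
elliptic curves» (the tree's Murty–Gordon theorem `IsIsogenous.lefschetzGroup_eq_hodgeGroup_of_pi_ellipticPeriod`); both
branches of the g33-#6 dichotomy at once. [cite: Gordon1997, 7.5 Theorem (b) and §3 Theorem] [cite: Murty1984, §3]
[cite: MoonenZarhin1999LowDim, §1 (p0002: "`Hg(X) ⊂ Sp_D(V,φ)`") and §3 Corollary] [cite: Lange2023AbelianVarietiesComplex, §7.2.4 Exercises (4), (5)] -/
theorem IsRiemannForm.lefschetzGroup_sigmaPiPeriod_eq_hodgeGroup_of_coe_eq_range (hg : ∀ k, 0 < finrank ℂ (F k))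
    (h : ∀ k, (hodgeGroup (Ψ k) : Set (SpecialLinearGroup (σ k) ℝ)) = Set.range (hodgeCircleSL (Ψ k)))
    {η : (∀ k, F k) [⋀^Fin 2]→L[ℝ] ℝ} (hη : IsRiemannForm (sigmaPiPeriod Ψ) η) :
    lefschetzGroup (sigmaPiPeriod Ψ) η = hodgeGroup (sigmaPiPeriod Ψ) := by
  obtain ⟨τ, hτ, N, c, -, -, -, -, hiso⟩ := exists_isIsogenous_piPeriod_ellipticPeriod_of_coe_eq_range Ψ hg h
  exact (hiso.symm _ _).lefschetzGroup_eq_hodgeGroup_of_pi_ellipticPeriod (fun i ↦ hτ (c i)) hη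

/-- **On the split branch `Lf(∏ₖ X_k)(ℝ) = ∏ₖ Hg(X_k)(ℝ) = ∏ₖ h_k(S¹)` for EVERY polarisation `η` of the product** (pairwise
`Hom = 0`; g33-#5). [cite: Gordon1997, 2.15 Lemma and 7.5 Theorem (b)] [cite: Lange2023AbelianVarietiesComplex, §7.2.4 Exercises (4)(a), (c)]
[cite: Imai1976HodgeGroups, §2 Proposition (p. 368)] -/
theorem IsRiemannForm.lefschetzGroup_sigmaPiPeriod_eq_map_of_coe_eq_range_of_pairwise_homRat_eq_bot
    (hg : ∀ k, 0 < finrank ℂ (F k))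
    (h : ∀ k, (hodgeGroup (Ψ k) : Set (SpecialLinearGroup (σ k) ℝ)) = Set.range (hodgeCircleSL (Ψ k)))
    (hhom : ∀ k l, k ≠ l → homRat (Ψ k) (Ψ l) = ⊥) {η : (∀ k, F k) [⋀^Fin 2]→L[ℝ] ℝ}
    (hη : IsRiemannForm (sigmaPiPeriod Ψ) η) :
    lefschetzGroup (sigmaPiPeriod Ψ) η = (Subgroup.pi Set.univ fun k ↦ hodgeGroup (Ψ k)).map (sigmaBlockDiagSL σ ℝ) := by
  rw [hη.lefschetzGroup_sigmaPiPeriod_eq_hodgeGroup_of_coe_eq_range Ψ hg h,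
    hodgeGroup_sigmaPiPeriod_eq_map_of_coe_eq_range_of_pairwise_homRat_eq_bot Ψ hg h hhom]

/-- **Off the split branch Lemma 2.15 fails: `Lf(∏ₖ X_k, η)(ℝ) < ∏ₖ Lf(X_k, ω_k)(ℝ)`** for every polarisation `η` of the
product and all polarisations `ω_k` of the factors, as soon as `Hom(X_l, X_k) ≠ 0` for some `k ≠ l` (tori on the locus:
`Lf(∏) = Hg(∏) < ∏ Hg(X_k) = ∏ Lf(X_k)`; the `Hom`-orthogonality hypothesis of `IsRiemannForm.lefschetzGroup_sigmaPi_eq` is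
necessary). [cite: Gordon1997, 2.15 Lemma] [cite: MoonenZarhin1999LowDim, §3 (1) (p0006 L53–L57)]
[cite: Lange2023AbelianVarietiesComplex, §7.2.4 Exercise (4)(c)] -/
theorem IsRiemannForm.lefschetzGroup_sigmaPiPeriod_lt_map_of_homRat_ne_bot (hg : ∀ k, 0 < finrank ℂ (F k))
    (h : ∀ k, (hodgeGroup (Ψ k) : Set (SpecialLinearGroup (σ k) ℝ)) = Set.range (hodgeCircleSL (Ψ k)))
    {ω : ∀ k, F k [⋀^Fin 2]→L[ℝ] ℝ} (hω : ∀ k, IsRiemannForm (Ψ k) (ω k)) {η : (∀ k, F k) [⋀^Fin 2]→L[ℝ] ℝ}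
    (hη : IsRiemannForm (sigmaPiPeriod Ψ) η) {k l : κ} (hkl : k ≠ l) (hne : homRat (Ψ l) (Ψ k) ≠ ⊥) :
    lefschetzGroup (sigmaPiPeriod Ψ) η < (Subgroup.pi Set.univ fun k ↦ lefschetzGroup (Ψ k) (ω k)).map (sigmaBlockDiagSL σ ℝ) := by
  have hf : (fun k ↦ lefschetzGroup (Ψ k) (ω k)) = fun k ↦ hodgeGroup (Ψ k) :=
    funext fun k ↦ (hω k).lefschetzGroup_eq_hodgeGroup_of_coe_hodgeGroup_eq_range (hg k) (h k)
  rw [hη.lefschetzGroup_sigmaPiPeriod_eq_hodgeGroup_of_coe_eq_range Ψ hg h, hf]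
  exact hodgeGroup_sigmaPi_lt_of_homRat_ne_bot Ψ hkl hne

/-! ## §4 When is the product itself on the locus? -/

/-- **THE PRODUCT OF A FINITE FAMILY OF TORI ON THE LOCUS IS ON THE LOCUS ⟺ `Hom_ℚ(X_k, X_l) ≠ 0` FOR ALL `k ≠ l`**
(⟺ all the CM curves `E_{τ_k}` are isogenous ⟺ `∏ₖ X_k ∼ E^{Σ g_k}` for one CM curve `E`): the `r`-factor form of g32-#1
(`X₁ × X₂` on the locus ⟺ `Hom(X₁, X₂) ≠ 0`), through the tree's `coe_hodgeGroup_eq_range_hodgeCircleSL_iff_of_isIsogenous_pi_ellipticPeriod`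
along §2. [cite: Imai1976HodgeGroups, §3 Remarks (p. 370 L22–L25)] [cite: MoonenZarhin1999LowDim, §1 and §3 Corollary]
[cite: Beauville2014MaximalPicard, §3 Prop. 3 and §4 Lemma 1] -/
theorem coe_hodgeGroup_sigmaPiPeriod_eq_range_iff_forall_homRat_ne_bot (hg : ∀ k, 0 < finrank ℂ (F k))
    (h : ∀ k, (hodgeGroup (Ψ k) : Set (SpecialLinearGroup (σ k) ℝ)) = Set.range (hodgeCircleSL (Ψ k))) :
    (hodgeGroup (sigmaPiPeriod Ψ) : Set (SpecialLinearGroup (Σ k, σ k) ℝ)) = Set.range (hodgeCircleSL (sigmaPiPeriod Ψ)) ↔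
      ∀ k l, k ≠ l → homRat (Ψ k) (Ψ l) ≠ ⊥ := by
  obtain ⟨τ, hτ, N, c, hpq, hX, hc, -, hiso⟩ := exists_isIsogenous_piPeriod_ellipticPeriod_of_coe_eq_range Ψ hg h
  choose p q hq using hpq
  have hcm : ∀ k, ellipticEnd (hτ k) ≠ ⊥ := fun k ↦ (ellipticEnd_ne_bot_iff (hτ k)).2 ⟨p k, q k, hq k⟩
  have key : ∀ a b : κ, a = b → IsIsogenous (ellipticPeriod (hτ a)) (ellipticPeriod (hτ b)) := by
    rintro a _ rfl
    exact IsIsogenous.refl _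
  rw [coe_hodgeGroup_eq_range_hodgeCircleSL_iff_of_isIsogenous_pi_ellipticPeriod (fun i ↦ hτ (c i)) hiso]
  constructor
  · rintro ⟨-, hall⟩ k l hkl
    obtain ⟨i, hi⟩ := hc k
    obtain ⟨j, hj⟩ := hc l
    have hkl' : IsIsogenous (ellipticPeriod (hτ k)) (ellipticPeriod (hτ l)) :=
      IsIsogenous.trans _ _ _ (IsIsogenous.trans _ _ _ (key _ _ hi.symm) (hall i j)) (key _ _ hj)
    exact fun hbot ↦ ((homRat_eq_bot_iff_not_isIsogenous_ellipticPeriod_of_isIsogenous_ellipticPow Ψ (hg k) (hg l)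
      (hτ k) (hτ l) (hcm k) (hX k) (hX l)).1 hbot) hkl'
  · intro hall
    refine ⟨fun i ↦ hcm (c i), fun i j ↦ ?_⟩
    by_cases hij : c i = c j
    · exact key _ _ hij
    · by_contra hni
      exact hall (c i) (c j) hij ((homRat_eq_bot_iff_not_isIsogenous_ellipticPeriod_of_isIsogenous_ellipticPow Ψ
        (hg _) (hg _) (hτ _) (hτ _) (hcm _) (hX _) (hX _)).2 hni)

/-- **… and then `Hg(∏ₖ X_k)(ℝ) = h(S¹)` has `dim_ℝ 𝔥𝔤_ℝ(∏ₖ X_k) = 1`** (the rank-one end of the range `1 ≤ rk ≤ #κ` of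
g33-#7; non-empty family). [cite: Imai1976HodgeGroups, §2 (p. 368 L5–L7) and §3 Remarks (p. 370)] [cite: MoonenZarhin1999LowDim, §1] -/
theorem finrank_hodgeGroupLie_sigmaPiPeriod_eq_one_of_forall_homRat_ne_bot [Nonempty κ] (hg : ∀ k, 0 < finrank ℂ (F k))
    (h : ∀ k, (hodgeGroup (Ψ k) : Set (SpecialLinearGroup (σ k) ℝ)) = Set.range (hodgeCircleSL (Ψ k)))
    (hall : ∀ k l, k ≠ l → homRat (Ψ k) (Ψ l) ≠ ⊥) : finrank ℝ (hodgeGroupLie (sigmaPiPeriod Ψ)) = 1 := by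
  have hpos : 0 < finrank ℂ (∀ k, F k) := by
    rw [Module.finrank_pi_fintype]
    exact Finset.sum_pos (fun k _ ↦ hg k) Finset.univ_nonempty
  exact (coe_hodgeGroup_eq_range_iff_finrank_hodgeGroupLie_eq_one (sigmaPiPeriod Ψ) hpos).1
    ((coe_hodgeGroup_sigmaPiPeriod_eq_range_iff_forall_homRat_ne_bot Ψ hg h).2 hall)

/-! ## §5 Tate's theorem for the product: `Dᵖ(∏ₖ X_k) = H^{2p}_Hodge(∏ₖ X_k)` -/

/-- **TATE'S THEOREM FOR EVERY FINITE PRODUCT OF TORI ON THE HODGE-CIRCLE LOCUS: `Dᵖ(∏ₖ X_k) = H^{2p}_Hodge(∏ₖ X_k)` for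
all `p`** — the rational Hodge classes of the product are spanned by products of divisor classes (the Hodge `(p,p)`
conjecture for `∏ₖ X_k`, in Lange's criterion form), since `∏ₖ X_k ∼ ∏ᵢ E_{τ_{c(i)}}` (§2) and «every complex torus isogenous to
a product of elliptic curves satisfies `Dᵖ(X) = H^{2p}_Hodge(X)`» (the tree's `IsIsogenous.divisorClasses_eq_hodgeClasses_of_pi_ellipticPeriod`).
[cite: vanGeemen1994HodgeAV, §4 Thm. 4.3 (Tate)] [cite: Gordon1997, §3 Theorem (second bullet) and 7.5 Theorem (b)]
[cite: Murty1984, §3] [cite: Lange2023AbelianVarietiesComplex, §7.3.1 and §7.3.3 Exercise (1)(b)] -/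
theorem divisorClasses_sigmaPiPeriod_eq_hodgeClasses_of_coe_eq_range (hg : ∀ k, 0 < finrank ℂ (F k))
    (h : ∀ k, (hodgeGroup (Ψ k) : Set (SpecialLinearGroup (σ k) ℝ)) = Set.range (hodgeCircleSL (Ψ k))) (p : ℕ) :
    divisorClasses (sigmaPiPeriod Ψ) p = hodgeClasses (sigmaPiPeriod Ψ) p := by
  obtain ⟨τ, hτ, N, c, -, -, -, -, hiso⟩ := exists_isIsogenous_piPeriod_ellipticPeriod_of_coe_eq_range Ψ hg h
  exact hiso.divisorClasses_eq_hodgeClasses_of_pi_ellipticPeriod _ (fun i ↦ hτ (c i)) p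

/-! ## §6 The Picard number of the product -/

/-- **`∏ₖ X_k ∼ E_{τ₁}^{n₁} × ⋯ × E_{τ_r}^{n_r}`** with `E_{τ_ν}` PAIRWISE NON-ISOGENOUS CM curves, `n_ν ≥ 1`, `Σ_ν n_ν = Σₖ g_k`,
`r ≤ #κ`, every factor `X_k ∼ E_{τ_ν}^{g_k}` for some `ν` — the isotypic regrouping of the curves of §2 («Decompose `X`, up
to isogeny, as `X ∼ Y₁^{m₁} × ⋯ × Y_r^{m_r}`», p10's `exists_isIsogenous_sigmaPiPeriod_powers`).
[cite: MoonenZarhin1999LowDim, (0.2)(4) (p0002 L1–L3)] [cite: Lange2023AbelianVarietiesComplex, §2.4.4 Thm. 2.4.25]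
[cite: Beauville2014MaximalPicard, §3 Prop. 3] -/
theorem exists_isIsogenous_sigmaPi_ellipticPow_of_coe_eq_range (hg : ∀ k, 0 < finrank ℂ (F k))
    (h : ∀ k, (hodgeGroup (Ψ k) : Set (SpecialLinearGroup (σ k) ℝ)) = Set.range (hodgeCircleSL (Ψ k))) :
    ∃ (r : ℕ) (τ : Fin r → ℂ) (hτ : ∀ ν, (τ ν).im ≠ 0) (n : Fin r → ℕ),
      r ≤ Fintype.card κ ∧ (∀ ν, ∃ p q : ℚ, τ ν ^ 2 + p * τ ν + q = 0) ∧
      (∀ ν ν', ν ≠ ν' → ¬ IsIsogenous (ellipticPeriod (hτ ν)) (ellipticPeriod (hτ ν'))) ∧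
      (∀ ν, 0 < n ν) ∧ ∑ ν, n ν = ∑ k, finrank ℂ (F k) ∧
      (∀ k, ∃ ν, IsIsogenous (Ψ k) (powPeriod (ellipticPeriod (hτ ν)) (finrank ℂ (F k)))) ∧
      IsIsogenous (sigmaPiPeriod Ψ) (sigmaPiPeriod fun ν ↦ powPeriod (ellipticPeriod (hτ ν)) (n ν)) := by
  have hex := fun k ↦ (coe_hodgeGroup_eq_range_iff_exists_isIsogenous_ellipticPow_quadratic (Ψ k) (hg k)).1 (h k)
  choose τ hτ hpq hX using hex
  choose p q hq using hpq
  have h1 : IsIsogenous (sigmaPiPeriod Ψ)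
      (sigmaPiPeriod fun k ↦ powPeriod (ellipticPeriod (hτ k)) (finrank ℂ (F k))) :=
    IsIsogenous.sigmaPi Ψ _ hX
  have h2 : IsIsogenous (sigmaPiPeriod fun k ↦ powPeriod (ellipticPeriod (hτ k)) (finrank ℂ (F k)))
      (sigmaPiPeriod fun k ↦ sigmaPiPeriod fun _ : Fin (finrank ℂ (F k)) ↦ ellipticPeriod (hτ k)) :=
    IsIsogenous.sigmaPi _ _ fun k ↦ (isIsomorphic_powPeriod_sigmaPiPeriod_const (ellipticPeriod (hτ k)) _).isIsogenous
  have h3 : IsIsogenous (sigmaPiPeriod fun k ↦ sigmaPiPeriod fun _ : Fin (finrank ℂ (F k)) ↦ ellipticPeriod (hτ k))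
      (sigmaPiPeriod fun s : (Σ k, Fin (finrank ℂ (F k))) ↦ ellipticPeriod (hτ s.1)) :=
    (isIsomorphic_sigmaPiPeriod_regroup (fun s : (Σ k, Fin (finrank ℂ (F k))) ↦ ellipticPeriod (hτ s.1))
      (Equiv.refl (Σ k, Fin (finrank ℂ (F k))))).symm.isIsogenous
  have hA : IsIsogenous (sigmaPiPeriod Ψ) (sigmaPiPeriod fun s : (Σ k, Fin (finrank ℂ (F k))) ↦ ellipticPeriod (hτ s.1)) :=
    IsIsogenous.trans _ _ _ (IsIsogenous.trans _ _ _ h1 h2) h3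
  obtain ⟨r, rep, n, hne, hn, hsum, hcls, hiso⟩ :=
    exists_isIsogenous_sigmaPiPeriod_powers fun s : (Σ k, Fin (finrank ℂ (F k))) ↦ ellipticPeriod (hτ s.1)
  have key : ∀ a b : κ, a = b → IsIsogenous (ellipticPeriod (hτ a)) (ellipticPeriod (hτ b)) := by
    rintro a _ rfl
    exact IsIsogenous.refl _
  have hinj : Function.Injective fun ν ↦ (rep ν).1 := by
    intro ν ν' hνν'
    by_contra hne'
    exact hne ν ν' hne' (key _ _ hνν')
  refine ⟨r, fun ν ↦ τ (rep ν).1, fun ν ↦ hτ (rep ν).1, n, ?_, fun ν ↦ ⟨p _, q _, hq _⟩, hne, hn, ?_, fun k ↦ ?_,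
    IsIsogenous.trans _ _ _ hA hiso⟩
  · have hcard := Fintype.card_le_of_injective _ hinj
    rwa [Fintype.card_fin] at hcard
  · rw [hsum, Fintype.card_sigma]
    exact Finset.sum_congr rfl fun k _ ↦ Fintype.card_fin _
  · obtain ⟨ν, hν⟩ := hcls ⟨k, ⟨0, hg k⟩⟩
    exact ⟨ν, (hX k).trans _ _ _ (hν.pow _ _ _)⟩

/-- **THE PICARD NUMBER OF A FINITE PRODUCT OF TORI ON THE HODGE-CIRCLE LOCUS: `ρ(∏ₖ X_k) = Σ_ν n_ν²`**, where `n_ν ≥ 1`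
(`Σ_ν n_ν = Σₖ g_k`, `r ≤ #κ` classes) is the total dimension of the factors whose CM curve lies in the `ν`-th isogeny class
(`∏ₖ X_k ∼ ∏_ν E_{τ_ν}^{n_ν}`; Hulek–Laface Cor. 2.3 «`ρ(∏ A_i^{n_i}) = Σ ρ(A_i^{n_i})`» and `ρ(E_τⁿ) = n²` for CM `E_τ`).
[cite: HulekLaface2019PicardNumbersAV, §2.1 Cor. 2.3] [cite: Lange2023AbelianVarietiesComplex, §7.3.3 Exercise (3)(b) and §2.6.3 Exercise (2)]
[cite: Beauville2014MaximalPicard, §3 Prop. 3] -/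
theorem exists_finrank_neronSeveriGroup_sigmaPiPeriod_eq_sum_sq_of_coe_eq_range (hg : ∀ k, 0 < finrank ℂ (F k))
    (h : ∀ k, (hodgeGroup (Ψ k) : Set (SpecialLinearGroup (σ k) ℝ)) = Set.range (hodgeCircleSL (Ψ k))) :
    ∃ (r : ℕ) (n : Fin r → ℕ), r ≤ Fintype.card κ ∧ (∀ ν, 0 < n ν) ∧ ∑ ν, n ν = ∑ k, finrank ℂ (F k) ∧
      finrank ℤ (neronSeveriGroup (sigmaPiPeriod Ψ)) = ∑ ν, n ν ^ 2 := by
  obtain ⟨r, τ, hτ, n, hr, hpq, hne, hn, hsum, -, hiso⟩ := exists_isIsogenous_sigmaPi_ellipticPow_of_coe_eq_range Ψ hg h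
  choose p q hq using hpq
  refine ⟨r, n, hr, hn, hsum, ?_⟩
  rw [hiso.finrank_neronSeveriGroup_eq _ _,
    finrank_neronSeveriGroup_powers (fun ν ↦ ellipticPeriod (hτ ν)) n (fun ν ↦ isSimple_ellipticPeriod (hτ ν))
      (fun ν ↦ isAbelianVariety_ellipticPeriod (hτ ν)) hne]
  exact Finset.sum_congr rfl fun ν _ ↦ finrank_neronSeveriGroup_ellipticPow_of_quadratic (hτ ν) (n ν) (hq ν)

/-- **On the split branch `ρ(∏ₖ X_k) = Σₖ g_k²`** (pairwise `Hom = 0`: Cor. 2.3's additivity and `ρ(X_k) = g_k²`, the maximal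
Picard number of a factor on the locus). [cite: HulekLaface2019PicardNumbersAV, §2.1 Cor. 2.3] [cite: Beauville2014MaximalPicard, §3 Prop. 3] -/
theorem finrank_neronSeveriGroup_sigmaPiPeriod_eq_sum_sq_of_pairwise_homRat_eq_bot (hg : ∀ k, 0 < finrank ℂ (F k))
    (h : ∀ k, (hodgeGroup (Ψ k) : Set (SpecialLinearGroup (σ k) ℝ)) = Set.range (hodgeCircleSL (Ψ k)))
    (hhom : ∀ k l, k ≠ l → homRat (Ψ k) (Ψ l) = ⊥) :
    finrank ℤ (neronSeveriGroup (sigmaPiPeriod Ψ)) = ∑ k, finrank ℂ (F k) ^ 2 := by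
  rw [finrank_neronSeveriGroup_sigmaPi_eq_sum_of_forall_ne Ψ
    (fun k ↦ isAbelianVariety_of_coe_hodgeGroup_eq_range (hg k) (h k)) hhom]
  exact Finset.sum_congr rfl fun k _ ↦ finrank_neronSeveriGroup_eq_sq_of_coe_hodgeGroup_eq_range (hg k) (h k)

/-- **`ρ(∏ₖ X_k) ≤ (Σₖ g_k)²`, with equality ⟺ `Hom(X_k, X_l) ≠ 0` for all `k ≠ l`** (total dimension `≥ 2`): maximal Picard
number ⟺ the product is on the locus (Beauville's Prop. 3 for `∏ₖ X_k`) ⟺ §4.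
[cite: Beauville2014MaximalPicard, §3 Prop. 3] [cite: HulekLaface2019PicardNumbersAV, §3.1 Prop. 3.1]
[cite: Lange2023AbelianVarietiesComplex, §1.3.4 Exercise (10)(b) and §2.6.3 Exercise (2)] -/
theorem finrank_neronSeveriGroup_sigmaPiPeriod_eq_sq_iff_forall_homRat_ne_bot (hg : ∀ k, 0 < finrank ℂ (F k))
    (h : ∀ k, (hodgeGroup (Ψ k) : Set (SpecialLinearGroup (σ k) ℝ)) = Set.range (hodgeCircleSL (Ψ k)))
    (h2 : 2 ≤ ∑ k, finrank ℂ (F k)) :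
    finrank ℤ (neronSeveriGroup (sigmaPiPeriod Ψ)) = (∑ k, finrank ℂ (F k)) ^ 2 ↔
      ∀ k l, k ≠ l → homRat (Ψ k) (Ψ l) ≠ ⊥ := by
  have hpi : finrank ℂ (∀ k, F k) = ∑ k, finrank ℂ (F k) := Module.finrank_pi_fintype ℂ
  rw [← coe_hodgeGroup_sigmaPiPeriod_eq_range_iff_forall_homRat_ne_bot Ψ hg h, ← hpi,
    coe_hodgeGroup_eq_range_iff_finrank_neronSeveriGroup_eq_sq (sigmaPiPeriod Ψ) (hpi ▸ h2)]

omit [DecidableEq κ] [∀ k, DecidableEq (σ k)] in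
/-- The general bound `ρ(∏ₖ X_k) ≤ (Σₖ g_k)²` (any complex torus: `ρ ≤ g²`). [cite: Lange2023AbelianVarietiesComplex, §1.3.4 Exercise (10)(b)]
[cite: HulekLaface2019PicardNumbersAV, §3.1 Prop. 3.1] -/
theorem finrank_neronSeveriGroup_sigmaPiPeriod_le_sq :
    finrank ℤ (neronSeveriGroup (sigmaPiPeriod Ψ)) ≤ (∑ k, finrank ℂ (F k)) ^ 2 := by
  rw [← Module.finrank_pi_fintype ℂ]
  exact finrank_neronSeveriGroup_le_sq (sigmaPiPeriod Ψ)

end Locus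

end ComplexTorus

end Literature.Geometry.Kaehler
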